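import Summits.HubbardSuperconductivity.HubbardSuperconductivity.Theorems.AnisotropyChordEnergyConvexityDefs
import Literature.MathematicalPhysics.QuantumLattice.GibbsTwoTimeBound

/-!
# Route `AnisotropyChord`: the HEAT-KERNEL RATE of a vector — `−t⁻¹ log ⟨v, e^{−tH} v⟩` tends to the
# bottom of the spectral support of `v` (lemma R of the theory seat's PORT-SPEC §71, intrinsic form;
# finite-dimensional spectral theory, proved)

For a Hermitian matrix `H` with eigenvector unitary `U` and eigenvalues `λ`, and a vector `v`, write
`y = U⋆ v` for its eigen-coordinates.

* `heatKernel_form_eq_sum` — `⟨v, e^{−tH} v⟩ = Σ_k |y_k|² e^{−tλ_k}` (`e^{−tH} = gibbsWeight t H`, the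
  tree's `gibbsWeight_eq_conj_diagonal`);
* `heatKernel_form_pos` — it is positive for `v ≠ 0`;
* `heatKernel_rate` — **lemma R (intrinsic)**: if `E` is the least eigenvalue carrying weight
  (`y_k ≠ 0 ⇒ E ≤ λ_k`, and `λ_k = E` for some `k` with `y_k ≠ 0`) then
  `−t⁻¹ log Re⟨v, e^{−tH} v⟩ → E` (sandwich `|y_{k₀}|² e^{−tE} ≤ c(t) ≤ ‖v‖² e^{−tE}` and
  `rate_of_exp_sandwich` of `…EnergyConvexityDefs`).

This is the spectral input of the theory seat's E-CONV argument (memo ROTOR-THEORY-6 §67/§71 S5):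
with `v = 𝟙_W` and `E = E_W` it turns log-concavity of the heat amplitudes into convexity of the sector
energies (`midpoint_convex_of_logConcave_rates`).  The identification of `E` with a sector energy
(`v` in an invariant subspace on which `H ≥ E`, meeting an `E`-eigenvector) is the companion step.
O. Bratteli, D. Robinson, *Operator Algebras and Quantum Statistical Mechanics* II §5.3.1; B. Simon,
*The Statistical Mechanics of Lattice Gases* I §II.  No definition is introduced.
-/

set_option linter.dupNamespace false

noncomputable section

namespace Summit.HubbardSuperconductivity.HubbardSuperconductivity.Theorems.AnisotropyChord

open Matrix Complex Finset Filter Topology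
open scoped ComplexOrder
open Literature.MathematicalPhysics.QuantumLattice

variable {ι : Type*} [Fintype ι] [DecidableEq ι]

/-- **The heat-kernel amplitude in eigen-coordinates**: `⟨v, e^{−tH} v⟩ = Σ_k |(U⋆v)_k|² e^{−tλ_k}`.
Bratteli–Robinson II §5.3.1. [folklore] -/
theorem heatKernel_form_eq_sum {H : Matrix ι ι ℂ} (hH : H.IsHermitian) (v : ι → ℂ) (t : ℝ) :
    star v ⬝ᵥ (gibbsWeight t H *ᵥ v) =
      ∑ k, ((‖(star (hH.eigenvectorUnitary : Matrix ι ι ℂ) *ᵥ v) k‖ ^ 2 *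
        Real.exp (-t * hH.eigenvalues k) : ℝ) : ℂ) := by
  set U : Matrix ι ι ℂ := (hH.eigenvectorUnitary : Matrix ι ι ℂ) with hU
  set y : ι → ℂ := star U *ᵥ v with hy
  rw [gibbsWeight_eq_conj_diagonal hH t, ← hU]
  have hstar : (star hH.eigenvectorUnitary : Matrix ι ι ℂ) = star U := rfl
  rw [hstar, ← mulVec_mulVec, ← mulVec_mulVec, ← hy, dotProduct_mulVec]
  have hvU : star v ᵥ* U = star y := by
    rw [hy, star_mulVec, star_eq_conjTranspose, conjTranspose_conjTranspose]
  rw [hvU, dotProduct]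
  refine Finset.sum_congr rfl fun k _ => ?_
  rw [mulVec_diagonal, Pi.star_apply]
  have hn : star (y k) * y k = ((‖y k‖ ^ 2 : ℝ) : ℂ) := by
    rw [Complex.star_def, Complex.conj_mul', Complex.ofReal_pow]
  rw [Complex.ofReal_mul, ← hn]
  ring

/-- The heat-kernel amplitude is real: `Re⟨v, e^{−tH} v⟩ = Σ_k |(U⋆v)_k|² e^{−tλ_k}`. [folklore] -/
theorem heatKernel_form_re {H : Matrix ι ι ℂ} (hH : H.IsHermitian) (v : ι → ℂ) (t : ℝ) :
    (star v ⬝ᵥ (gibbsWeight t H *ᵥ v)).re =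
      ∑ k, ‖(star (hH.eigenvectorUnitary : Matrix ι ι ℂ) *ᵥ v) k‖ ^ 2 * Real.exp (-t * hH.eigenvalues k) := by
  rw [heatKernel_form_eq_sum hH v t, ← Complex.ofReal_sum, Complex.ofReal_re]

/-- The eigen-coordinates of a nonzero vector are not all zero. [folklore] -/
theorem eigenCoord_ne_zero {H : Matrix ι ι ℂ} (hH : H.IsHermitian) {v : ι → ℂ} (hv : v ≠ 0) :
    ∃ k, (star (hH.eigenvectorUnitary : Matrix ι ι ℂ) *ᵥ v) k ≠ 0 := by
  by_contra h
  push Not at h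
  have hy : star (hH.eigenvectorUnitary : Matrix ι ι ℂ) *ᵥ v = 0 := funext h
  have : v = 0 := by
    have hUU : (hH.eigenvectorUnitary : Matrix ι ι ℂ) * star (hH.eigenvectorUnitary : Matrix ι ι ℂ) = 1 :=
      Unitary.coe_mul_star_self _
    have e : v = (hH.eigenvectorUnitary : Matrix ι ι ℂ) *ᵥ (star (hH.eigenvectorUnitary : Matrix ι ι ℂ) *ᵥ v) := by
      rw [mulVec_mulVec, hUU, one_mulVec]
    rw [e, hy, mulVec_zero]
  exact hv this

/-- **Positivity of the heat-kernel amplitude**: `Re⟨v, e^{−tH} v⟩ > 0` for `v ≠ 0`. [folklore] -/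
theorem heatKernel_form_pos {H : Matrix ι ι ℂ} (hH : H.IsHermitian) {v : ι → ℂ} (hv : v ≠ 0) (t : ℝ) :
    0 < (star v ⬝ᵥ (gibbsWeight t H *ᵥ v)).re := by
  rw [heatKernel_form_re hH v t]
  obtain ⟨k₀, hk₀⟩ := eigenCoord_ne_zero hH hv
  have hle : ∀ k ∈ (Finset.univ : Finset ι),
      0 ≤ ‖(star (hH.eigenvectorUnitary : Matrix ι ι ℂ) *ᵥ v) k‖ ^ 2 * Real.exp (-t * hH.eigenvalues k) :=
    fun k _ => mul_nonneg (sq_nonneg _) (Real.exp_pos _).le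
  exact lt_of_lt_of_le (mul_pos (by positivity) (Real.exp_pos _)) (Finset.single_le_sum hle (Finset.mem_univ k₀))

/-- **LEMMA R (intrinsic form): the heat-kernel rate of `v` is the least eigenvalue carrying weight.**
If `E ≤ λ_k` whenever `(U⋆v)_k ≠ 0`, and `λ_{k₀} = E` for some `k₀` with `(U⋆v)_{k₀} ≠ 0`, then
`−t⁻¹ log Re⟨v, e^{−tH} v⟩ → E` as `t → ∞`.  Theory seat memo ROTOR-THEORY-6 §71 (lemma R);
Bratteli–Robinson II §5.3.1. [folklore] -/
theorem heatKernel_rate {H : Matrix ι ι ℂ} (hH : H.IsHermitian) (v : ι → ℂ) {E : ℝ}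
    (hmin : ∀ k, (star (hH.eigenvectorUnitary : Matrix ι ι ℂ) *ᵥ v) k ≠ 0 → E ≤ hH.eigenvalues k)
    (hatt : ∃ k, (star (hH.eigenvectorUnitary : Matrix ι ι ℂ) *ᵥ v) k ≠ 0 ∧ hH.eigenvalues k = E) :
    Tendsto (fun t : ℝ => -Real.log ((star v ⬝ᵥ (gibbsWeight t H *ᵥ v)).re) / t) atTop (𝓝 E) := by
  set y : ι → ℂ := star (hH.eigenvectorUnitary : Matrix ι ι ℂ) *ᵥ v with hy
  obtain ⟨k₀, hk₀, hl0⟩ := hatt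
  have ha : 0 < ‖y k₀‖ ^ 2 := by positivity
  refine rate_of_exp_sandwich (c := fun t => (star v ⬝ᵥ (gibbsWeight t H *ᵥ v)).re)
    (a := ‖y k₀‖ ^ 2) (b := ∑ k, ‖y k‖ ^ 2) (t₀ := 0) ha ?_ ?_
  · intro t ht
    rw [heatKernel_form_re hH v t]
    have hle : ∀ k ∈ (Finset.univ : Finset ι), 0 ≤ ‖y k‖ ^ 2 * Real.exp (-t * hH.eigenvalues k) :=
      fun k _ => mul_nonneg (sq_nonneg _) (Real.exp_pos _).le
    have := Finset.single_le_sum hle (Finset.mem_univ k₀)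
    rw [hl0] at this
    exact this
  · intro t ht
    rw [heatKernel_form_re hH v t, Finset.sum_mul]
    refine Finset.sum_le_sum fun k _ => ?_
    by_cases hk : y k = 0
    · have hk' : (star (hH.eigenvectorUnitary : Matrix ι ι ℂ) *ᵥ v) k = 0 := hk
      rw [hk', norm_zero]
      simp only [ne_eq, OfNat.ofNat_ne_zero, not_false_eq_true, zero_pow, zero_mul]
      positivity
    · refine mul_le_mul_of_nonneg_left ?_ (sq_nonneg _)
      exact Real.exp_le_exp.2 (by nlinarith [hmin k hk])

end Summit.HubbardSuperconductivity.HubbardSuperconductivity.Theorems.AnisotropyChord
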